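import Summits.ResolutionOfSingularities.ResolutionOfSingularities.Theorems.PurelyInseparableDim4ChartTransfer
import HarnessLib

/-!
# Purely inseparable four-folds `z^p + F(x₁, …, x₄)`: the chart dictionary for coordinate centres,
# SCHEME LEVEL III (brick TY-2 (d) of cell `res-dim4-pi`: the boundary — exceptional hyperplanes on
# the chart = the tree's `CentreBlowup.newExc`)

[OURS · counted 0] (D-0157 DOOR 2; director-resolution DR-157-C; desk `boards/WAVE2.md` row TY-2,
«(+ the marked-ideal form)»). Sequel of `PurelyInseparableDim4ChartTransfer.lean`. The marked ideal
of the class carries a BOUNDARY: the exceptional hyperplanes `H_i = V(x_i)`, `i ∈ exc`, of the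
presented state `(F, r, exc)` (`CentreBlowup.CState.exc`); under a blow-up the boundary transforms by
STRICT transforms of the old members plus the new exceptional divisor (`MarkedIdeal.transform`:
`E' = E.map (strictTransformIdeal σ C) ++ [σ⁻¹C·𝒪]`, BGMW Def. 3.1.3 (4)). This file computes these
on the `x_j`-chart of ANY blowing up `π : W → 𝔸⁵_K` along `V(z, x_S)` (`IsBlowup` of
`AffineCoordBlowup.𝓘Λ 4 K Λ_S`, `j ∈ S`), for the coordinate hyperplane sheaves
`H_i = xᵢ·𝒪 = ofIdealTop (span {coord 4 K i.succ})` of `𝔸⁵_K` — PROVED, no `sorry`, no new axiom: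

* `strictTransformIdeal_hyperplane_comap_chartImm` — for `i ≠ j` the strict transform of `H_i`
  restricted to the `x_j`-chart is `H_i` again (`ψ(x_i) = x_j x_i` or `x_i`, saturated by `x_j`);
* `strictTransformIdeal_hyperplane_self_comap_chartImm` — the strict transform of `H_j` MISSES the
  `x_j`-chart (it is the unit ideal sheaf there);
* `comap_𝓘Λ_chartImm` (previous file) — the new exceptional divisor on the chart is `H_j`;
* `comap_hyperplane_specMap` — under the re-centring/cleaning automorphism `Θ` of the chart
  (`Θ(xᵢ) = xᵢ + bᵢ`, any such ring endomorphism) `H_i` pulls back to `V(xᵢ + bᵢ)`, which is `H_i`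
  iff `bᵢ = 0`; `comap_hyperplane_chart` / `comap_hyperplane_self_chart` / `comap_exceptional_chart`
  — the three composite statements along `Spec Θ ≫ chartImm`.

Together with `transform_ideal_chart_eq_step` (`PurelyInseparableDim4ChartStep.lean`) this is the
full marked-ideal dictionary of one step on the re-centred cleaned chart: ideal `(z^p + step.F)·𝒪`,
boundary = the hyperplanes `V(xᵢ + bᵢ)` (`i ∈ exc ∖ j`) and `V(x_j)` — through the new origin exactly
for `i ∈ CentreBlowup.newExc j b s = insert j {i ∈ exc | bᵢ = 0}`, the tree's bookkeeping. Nothing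
here is a statement about resolution of singularities in dimension ≥ 4 / characteristic `p` (NOT proved
anywhere in this programme). bears_on: LADDER-RESOLUTION:D157-DOOR2 (res-dim4-pi). Supports
stmt-ResolutionOfSingularities-16155 (helper, TY-2 (d)).
-/

-- every declaration of this summit lives under `Summit.ResolutionOfSingularities.ResolutionOfSingularities`
-- (summit = problem), which the duplicate-namespace linter flags; house convention (cf. the Target file).
set_option linter.dupNamespace false

noncomputable section

open MvPolynomial Finset CategoryTheory AlgebraicGeometry Opposite
open AlgebraicGeometry.Scheme.IdealSheafData (ofIdealTop)

namespace Summit.ResolutionOfSingularities.ResolutionOfSingularities.Theorems.PIDim4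

open Literature.AlgebraicGeometry.Resolution
open Literature.AlgebraicGeometry.Resolution.AffinePointBlowup (P A γ coord Wtop)

namespace ChartDictionary

section Boundary

variable {K : Type} [Field K] {S : Finset (Fin 4)} {j : Fin 4}

/-- Distinct coordinate functions do not divide each other in `Γ(𝔸⁵, ⊤)`. -/
theorem not_coord_dvd_coord {i l : Fin (4 + 1)} (hil : i ≠ l) : ¬ coord 4 K i ∣ coord 4 K l := by
  rintro ⟨c, hc⟩
  have h := congrArg (γ 4 K) hc
  rw [map_mul, AffinePointBlowup.γ_coord, AffinePointBlowup.γ_coord] at h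
  exact hil (MvPolynomial.X_dvd_X.mp ⟨γ 4 K c, h⟩)

/-- On the `x_j`-chart the base variable `xᵢ` (`i ≠ j`) transforms to `x_j^e · xᵢ` with `e = 1`
(`i ∈ S`) or `e = 0` (`i ∉ S`). -/
theorem exists_coordBlowupSubst_X_succ_eq (S : Finset (Fin 4)) {i j : Fin 4} (hij : i ≠ j) :
    ∃ e : ℕ, coordBlowupSubst K (insert 0 (Fin.succ '' (S : Set (Fin 4)))) j.succ (X i.succ) =
      X j.succ ^ e * X i.succ := by
  by_cases hi : i ∈ S
  · exact ⟨1, by rw [pow_one, coordBlowupSubst_X_of_mem_of_ne K _ j.succ (succ_mem_centreVars hi)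
      (fun h => hij (Fin.succ_inj.mp h))]⟩
  · exact ⟨0, by rw [pow_zero, one_mul, coordBlowupSubst_X_of_not_mem K _ j.succ
      (fun h => hi ((succ_mem_centreVars_iff S i).mp h))]⟩

/-- **Strict transform of an old exceptional hyperplane along the chart substitution**: for `i ≠ j`,
`⋃ₙ (ψ(xᵢ)·𝒪 : (x_j)ⁿ) = xᵢ·𝒪` (`ψ(xᵢ) = x_j^e xᵢ`, and the prime `x_j` does not divide `xᵢ`). -/
theorem strictTransformIdeal_specMap_subst_hyperplane (hj : j ∈ S) {i : Fin 4} (hij : i ≠ j) :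
    strictTransformIdeal
        (Spec.map (CommRingCat.ofHom
          (coordBlowupSubst K (insert 0 (Fin.succ '' (S : Set (Fin 4)))) j.succ).toRingHom))
        (AffineCoordBlowup.𝓘Λ 4 K (insert 0 (Fin.succ '' (S : Set (Fin 4)))))
        (ofIdealTop (Ideal.span {coord 4 K i.succ})) =
      ofIdealTop (Ideal.span {coord 4 K i.succ}) := by
  obtain ⟨e, he⟩ := exists_coordBlowupSubst_X_succ_eq (K := K) S hij
  rw [strictTransformIdeal, comap_𝓘Λ_specMap_subst (succ_mem_centreVars hj)]
  change ⨆ m : ℕ, colon ((ofIdealTop (Ideal.span {(γ 4 K).symm (X i.succ)})).comap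
      (Spec.map (CommRingCat.ofHom
        (coordBlowupSubst K (insert 0 (Fin.succ '' (S : Set (Fin 4)))) j.succ).toRingHom)))
      (ofIdealTop (Ideal.span {coord 4 K j.succ}) ^ m) = _
  rw [comap_ofIdealTop_span_γ_symm]
  change ⨆ m : ℕ, colon (ofIdealTop (Ideal.span {(γ 4 K).symm (coordBlowupSubst K _ j.succ (X i.succ))}))
      (ofIdealTop (Ideal.span {coord 4 K j.succ}) ^ m) = _
  rw [he, map_mul, map_pow]
  change ⨆ m : ℕ, colon (ofIdealTop (Ideal.span {coord 4 K j.succ ^ e * coord 4 K i.succ}))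
      (ofIdealTop (Ideal.span {coord 4 K j.succ}) ^ m) = _
  simp_rw [← ofIdealTop_pow, colon_ofIdealTop]
  rw [← ofIdealTop_iSup, iSup_colon_span_pow_mul_eq (prime_coord j.succ)
    (not_coord_dvd_coord (fun h => hij (Fin.succ_inj.mp h.symm)))]

/-- **The strict transform of the hyperplane `x_j = 0` misses the `x_j`-chart**: along the chart
substitution it is the unit ideal sheaf (`ψ(x_j) = x_j`, and `(x_j·𝒪 : x_j·𝒪) = 𝒪`). -/
theorem strictTransformIdeal_specMap_subst_hyperplane_self (hj : j ∈ S) :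
    strictTransformIdeal
        (Spec.map (CommRingCat.ofHom
          (coordBlowupSubst K (insert 0 (Fin.succ '' (S : Set (Fin 4)))) j.succ).toRingHom))
        (AffineCoordBlowup.𝓘Λ 4 K (insert 0 (Fin.succ '' (S : Set (Fin 4)))))
        (ofIdealTop (Ideal.span {coord 4 K j.succ})) = ⊤ := by
  rw [strictTransformIdeal, comap_𝓘Λ_specMap_subst (succ_mem_centreVars hj)]
  have hX : (ofIdealTop (Ideal.span {coord 4 K j.succ})).comap
      (Spec.map (CommRingCat.ofHom
        (coordBlowupSubst K (insert 0 (Fin.succ '' (S : Set (Fin 4)))) j.succ).toRingHom)) =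
      ofIdealTop (Ideal.span {coord 4 K j.succ}) := by
    change (ofIdealTop (Ideal.span {(γ 4 K).symm (X j.succ)})).comap _ = _
    rw [comap_ofIdealTop_span_γ_symm]
    change ofIdealTop (Ideal.span {(γ 4 K).symm (coordBlowupSubst K _ j.succ (X j.succ))}) = _
    rw [coordBlowupSubst_X_self]
    rfl
  rw [hX]
  refine eq_top_iff.mpr (le_iSup_of_le 1 (le_colon_iff.mpr ?_))
  rw [pow_one]
  exact fun U => Ideal.mul_le_right

variable {W : Scheme.{0}} {π : W ⟶ P 4 K}

/-- **BOUNDARY ON THE CHART (old components, `i ≠ j`)**: for ANY blowing up `π` of `𝔸⁵_K` along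
`V(z, x_S)` and `j ∈ S`, the strict transform of the exceptional hyperplane `V(xᵢ)`, `i ≠ j`,
restricted to the `x_j`-chart is `V(xᵢ)`. -/
theorem strictTransformIdeal_hyperplane_comap_chartImm (hj : j ∈ S) {i : Fin 4} (hij : i ≠ j)
    (hπ : IsBlowup π (AffineCoordBlowup.𝓘Λ 4 K (insert 0 (Fin.succ '' (S : Set (Fin 4)))))) :
    (strictTransformIdeal π (AffineCoordBlowup.𝓘Λ 4 K (insert 0 (Fin.succ '' (S : Set (Fin 4)))))
        (ofIdealTop (Ideal.span {coord 4 K i.succ}))).comap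
        (AffineCoordBlowup.chartImm hπ (succ_mem_centreVars hj)) =
      ofIdealTop (Ideal.span {coord 4 K i.succ}) := by
  haveI : IsProper π := hπ.isProper
  haveI : IsLocallyNoetherian W := LocallyOfFiniteType.isLocallyNoetherian π
  have hsq : AffineCoordBlowup.chartImm hπ (succ_mem_centreVars hj) ≫ π =
      Spec.map (CommRingCat.ofHom
        (coordBlowupSubst K (insert 0 (Fin.succ '' (S : Set (Fin 4)))) j.succ).toRingHom) ≫ 𝟙 (P 4 K) := by
    rw [Category.comp_id]
    exact AffineCoordBlowup.chartImm_comp hπ (succ_mem_centreVars hj)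
  rw [comap_strictTransformIdeal_of_flat (t := 𝟙 (P 4 K)) hsq, Scheme.IdealSheafData.comap_id,
    Scheme.IdealSheafData.comap_id, strictTransformIdeal_specMap_subst_hyperplane hj hij]

/-- **BOUNDARY ON THE CHART (the old component `V(x_j)`)**: its strict transform misses the
`x_j`-chart. -/
theorem strictTransformIdeal_hyperplane_self_comap_chartImm (hj : j ∈ S)
    (hπ : IsBlowup π (AffineCoordBlowup.𝓘Λ 4 K (insert 0 (Fin.succ '' (S : Set (Fin 4)))))) :
    (strictTransformIdeal π (AffineCoordBlowup.𝓘Λ 4 K (insert 0 (Fin.succ '' (S : Set (Fin 4)))))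
        (ofIdealTop (Ideal.span {coord 4 K j.succ}))).comap
        (AffineCoordBlowup.chartImm hπ (succ_mem_centreVars hj)) = ⊤ := by
  haveI : IsProper π := hπ.isProper
  haveI : IsLocallyNoetherian W := LocallyOfFiniteType.isLocallyNoetherian π
  have hsq : AffineCoordBlowup.chartImm hπ (succ_mem_centreVars hj) ≫ π =
      Spec.map (CommRingCat.ofHom
        (coordBlowupSubst K (insert 0 (Fin.succ '' (S : Set (Fin 4)))) j.succ).toRingHom) ≫ 𝟙 (P 4 K) := by
    rw [Category.comp_id]
    exact AffineCoordBlowup.chartImm_comp hπ (succ_mem_centreVars hj)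
  rw [comap_strictTransformIdeal_of_flat (t := 𝟙 (P 4 K)) hsq, Scheme.IdealSheafData.comap_id,
    Scheme.IdealSheafData.comap_id, strictTransformIdeal_specMap_subst_hyperplane_self hj]

/-! ### After re-centring at `b` and cleaning -/

/-- Under a ring endomorphism `Θ` of `K[z, x]` with `Θ(xᵢ) = xᵢ + c` (the re-centring/cleaning
automorphisms of `PurelyInseparableDim4ChartStep.lean` have this shape with `c = bᵢ`), the hyperplane
sheaf `V(xᵢ)` pulls back along `Spec Θ` to `V(xᵢ + c)`. -/
theorem comap_hyperplane_specMap {Θ : A 4 K →+* A 4 K} {i : Fin 4} {c : K}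
    (hΘ : Θ (X i.succ) = X i.succ + C c) :
    (ofIdealTop (Ideal.span {coord 4 K i.succ})).comap (Spec.map (CommRingCat.ofHom Θ)) =
      ofIdealTop (Ideal.span {(γ 4 K).symm (X i.succ + C c)}) := by
  change (ofIdealTop (Ideal.span {(γ 4 K).symm (X i.succ)})).comap _ = _
  rw [comap_ofIdealTop_span_γ_symm, hΘ]

/-- In particular a hyperplane `V(xᵢ)` whose variable `Θ` fixes (`c = 0`, e.g. `i = j`, or `bᵢ = 0`)
pulls back to itself. -/
theorem comap_hyperplane_specMap_of_fix {Θ : A 4 K →+* A 4 K} {i : Fin 4}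
    (hΘ : Θ (X i.succ) = X i.succ) :
    (ofIdealTop (Ideal.span {coord 4 K i.succ})).comap (Spec.map (CommRingCat.ofHom Θ)) =
      ofIdealTop (Ideal.span {coord 4 K i.succ}) := by
  rw [comap_hyperplane_specMap (c := 0) (by rw [hΘ, C_0, add_zero]), C_0, add_zero]
  rfl

/-- **BOUNDARY DICTIONARY (old components)** on the re-centred cleaned `x_j`-chart: for `i ≠ j` and
any `Θ` with `Θ(xᵢ) = xᵢ + bᵢ`, the strict transform of `V(xᵢ)` pulls back along `Spec Θ ≫ chartImm`
to `V(xᵢ + bᵢ)` — through the new origin iff `bᵢ = 0`, as in `CentreBlowup.newExc`. -/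
theorem comap_hyperplane_chart (hj : j ∈ S) {i : Fin 4} (hij : i ≠ j) {Θ : A 4 K →+* A 4 K}
    {b : Fin 4 → K} (hΘ : Θ (X i.succ) = X i.succ + C (b i))
    (hπ : IsBlowup π (AffineCoordBlowup.𝓘Λ 4 K (insert 0 (Fin.succ '' (S : Set (Fin 4)))))) :
    (strictTransformIdeal π (AffineCoordBlowup.𝓘Λ 4 K (insert 0 (Fin.succ '' (S : Set (Fin 4)))))
        (ofIdealTop (Ideal.span {coord 4 K i.succ}))).comap
        (Spec.map (CommRingCat.ofHom Θ) ≫ AffineCoordBlowup.chartImm hπ (succ_mem_centreVars hj)) =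
      ofIdealTop (Ideal.span {(γ 4 K).symm (X i.succ + C (b i))}) := by
  rw [Scheme.IdealSheafData.comap_comp, strictTransformIdeal_hyperplane_comap_chartImm hj hij hπ,
    comap_hyperplane_specMap hΘ]

/-- **BOUNDARY DICTIONARY (the old component `V(x_j)`)**: it does not meet the re-centred chart. -/
theorem comap_hyperplane_self_chart (hj : j ∈ S) (Θ : A 4 K →+* A 4 K)
    (hπ : IsBlowup π (AffineCoordBlowup.𝓘Λ 4 K (insert 0 (Fin.succ '' (S : Set (Fin 4)))))) :
    (strictTransformIdeal π (AffineCoordBlowup.𝓘Λ 4 K (insert 0 (Fin.succ '' (S : Set (Fin 4)))))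
        (ofIdealTop (Ideal.span {coord 4 K j.succ}))).comap
        (Spec.map (CommRingCat.ofHom Θ) ≫ AffineCoordBlowup.chartImm hπ (succ_mem_centreVars hj)) =
      ⊤ := by
  rw [Scheme.IdealSheafData.comap_comp, strictTransformIdeal_hyperplane_self_comap_chartImm hj hπ,
    Scheme.IdealSheafData.comap_top]

/-- **BOUNDARY DICTIONARY (the new exceptional divisor)**: for any `Θ` fixing `x_j` (the re-centring
has `b_j = 0` and the cleaning fixes the base variables) the exceptional ideal `π⁻¹𝓘Λ·𝒪_W` pulls back
along `Spec Θ ≫ chartImm` to the hyperplane `V(x_j)` through the new origin — the member `j` of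
`CentreBlowup.newExc j b s`. -/
theorem comap_exceptional_chart (hj : j ∈ S) {Θ : A 4 K →+* A 4 K} (hΘ : Θ (X j.succ) = X j.succ)
    (hπ : IsBlowup π (AffineCoordBlowup.𝓘Λ 4 K (insert 0 (Fin.succ '' (S : Set (Fin 4)))))) :
    ((AffineCoordBlowup.𝓘Λ 4 K (insert 0 (Fin.succ '' (S : Set (Fin 4))))).comap π).comap
        (Spec.map (CommRingCat.ofHom Θ) ≫ AffineCoordBlowup.chartImm hπ (succ_mem_centreVars hj)) =
      ofIdealTop (Ideal.span {coord 4 K j.succ}) := by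
  rw [Scheme.IdealSheafData.comap_comp, comap_𝓘Λ_chartImm hj hπ, comap_hyperplane_specMap_of_fix hΘ]

end Boundary

end ChartDictionary

end Summit.ResolutionOfSingularities.ResolutionOfSingularities.Theorems.PIDim4

end
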